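import Summits.CriticalPhenomena.PercolationContinuityZ3.Theorems.PercNearOneGluingAdditiveGluingKnThm2GoodAux
import HarnessLib

/-! # Crux `PercNearOneGluing.AdditiveGluing` (stmt-CriticalPhenomena-4576), line `tieline`
(lead c7) — stub `stub_lincombIntegral_c7` (integrating a certificate)

Helper file for the crux skeleton of the line `tieline` (lead
prover-line-stmt-CriticalPhenomena-4576-c7-0): proves exactly the registered stub signature
`stub_lincombIntegral_c7`; lands with `--supports stmt-CriticalPhenomena-4576`.

## Content

On the finite configuration space `BondConfig (Fin n) = Set (Sym2 (Fin n))` (discrete σ-algebra,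
`μ = prodBernoulli w` a probability measure), a pointwise inequality between a finite linear
combination of indicators and `0`,

`0 ≤ Σ_i c_i · 1[E_i](ω)` for every `ω`,

integrates to `0 ≤ Σ_i c_i · μ(E_i)`.  The combination is indexed by an explicit
`List (ℝ × Set (BondConfig (Fin n)))` of (coefficient, event) pairs, so that the lead can
instantiate it with a list literal and expand with `List.map_cons, List.sum_cons`.

Proof: linearity of the Bochner integral by induction on the list
(`integral_add`, `integral_const_mul`, `integral_indicator_one`; every function on the finite
space is integrable, `Integrable.of_finite`, every set measurable, `MeasurableSet.of_discrete`),
then `integral_nonneg`.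
-/

namespace Summit.CriticalPhenomena.PercolationContinuityZ3.Theorems

open MeasureTheory Set Literature.Probability.LatticeModels Literature.Probability.Percolation

noncomputable section
open Classical

variable {n : ℕ}

/-- Linearity of the integral over a list of (coefficient, event) pairs on the finite
configuration space: `∫ Σ_i c_i 1[E_i] dμ = Σ_i c_i μ(E_i)` for `μ = prodBernoulli w`.
[folklore] -/
theorem lincombIntegral_integral_eq (w : Sym2 (Fin n) → unitInterval)
    (l : List (ℝ × Set (BondConfig (Fin n)))) :
    (∫ ω, (l.map fun ce => ce.1 * ce.2.indicator (1 : BondConfig (Fin n) → ℝ) ω).sum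
        ∂(prodBernoulli w)) =
      (l.map fun ce => ce.1 * (prodBernoulli w).real ce.2).sum := by
  induction l with
  | nil => simp
  | cons ce l ih =>
    simp only [List.map_cons, List.sum_cons]
    rw [integral_add Integrable.of_finite Integrable.of_finite, ih, integral_const_mul,
      integral_indicator_one MeasurableSet.of_discrete]

/-- **Integrating a certificate.** If `0 ≤ Σ_i c_i · 1[E_i](ω)` for every configuration `ω` of
the finite weighted graph on `Fin n`, then `0 ≤ Σ_i c_i · μ(E_i)` for `μ = prodBernoulli w`; the
linear combination is given by an explicit list of (coefficient, event) pairs. [folklore] -/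
theorem stub_lincombIntegral_c7 : ∀ (n : ℕ) (w : Sym2 (Fin n) → unitInterval) (l : List (ℝ × Set (BondConfig (Fin n)))), (∀ ω : BondConfig (Fin n), 0 ≤ (l.map fun ce => ce.1 * ce.2.indicator (1 : BondConfig (Fin n) → ℝ) ω).sum) → 0 ≤ (l.map fun ce => ce.1 * (prodBernoulli w).real ce.2).sum := by
  intro n w l hl
  rw [← lincombIntegral_integral_eq w l]
  exact integral_nonneg hl

end

end Summit.CriticalPhenomena.PercolationContinuityZ3.Theorems
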